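import Summits.ResolutionOfSingularities.ResolutionOfSingularities.Theorems.WeightedInvariantIota3RootCurve
import HarnessLib

/-!
# THE SECOND ROOT: `Σ_{c ≤ n} C(μ_c) V^{ρ(n−c)} P^c = 0` over a domain with `μ₀ ≠ 0 ≠ μ_n`, `n ≥ 1` forces `P = g·V^ρ`
# (door `HypersurfaceCentreConstruction`, stmt-ResolutionOfSingularities-19897; step (3) of LEMMA C′ for `r₂ ∣ r₁`, memo RESIDUE-PLAN.md §3b)

Helper for `stub_keyRungGrHomLE_three` (def-free, `--supports 19897`).  One-variable polynomial algebra over a DOMAIN `R` (in the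
application `R = κ[X]`, `V` the second variable): `PolynomialD.eq_zero_of_natDegree_injOn` (no cancellation, domain version),
`PolynomialD.natTrailingDegree_pow`, and **`PolynomialD.eq_C_mul_X_pow_of_rootRelation`**: if `P ≠ 0` and
`Σ_{c ≤ n} C(μ_c) X^{ρ(n−c)} P^c = 0` with `μ₀ ≠ 0`, `μ_n ≠ 0`, then `deg P = ord P = ρ`, so `P = C g * X^ρ` with `g ≠ 0` and
`Σ_c μ_c g^c = 0` (top degrees are `ρn + c(deg P − ρ)`, lowest orders `ρn − c(ρ − ord P)`; no cancellation at `c = 0`, resp. `c = n`).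
[OURS · L1 W4.3 · (o70-b)/(Δ12); AI work, weaker than expert review; nothing here is a statement of the manuscript under review.]
-/

noncomputable section

open Polynomial

set_option linter.dupNamespace false -- mandated namespace of this single-conjunct summit

namespace Summit.ResolutionOfSingularities.ResolutionOfSingularities.Cruxes.HypersurfaceCentreConstruction.LocalEngine

namespace Iota3

namespace PolynomialD

variable {R : Type} [CommRing R] [IsDomain R]

omit [IsDomain R] in
/-- No cancellation among distinct degrees (commutative-ring version of `Polynomial3.eq_zero_of_natDegree_injOn`). [folklore] -/
theorem eq_zero_of_natDegree_injOn {ι : Type} (s : Finset ι) (f : ι → R[X])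
    (hdist : ∀ i ∈ s, ∀ i' ∈ s, i ≠ i' → f i ≠ 0 → f i' ≠ 0 → (f i).natDegree ≠ (f i').natDegree)
    (hsum : ∑ i ∈ s, f i = 0) : ∀ i ∈ s, f i = 0 := by
  classical
  by_contra hne
  push Not at hne
  obtain ⟨i₀, hi₀, hmax⟩ := Finset.exists_max_image (s.filter fun i => f i ≠ 0) (fun i => (f i).natDegree)
    (by obtain ⟨i, hi, hfi⟩ := hne; exact ⟨i, Finset.mem_filter.mpr ⟨hi, hfi⟩⟩)
  obtain ⟨hi₀s, hfi₀⟩ := Finset.mem_filter.mp hi₀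
  have hrest : (∑ i ∈ s.erase i₀, f i).natDegree < (f i₀).natDegree ∨ ∑ i ∈ s.erase i₀, f i = 0 := by
    by_cases hz : ∀ i ∈ s.erase i₀, f i = 0
    · exact Or.inr (Finset.sum_eq_zero hz)
    · left
      push Not at hz
      have hlt : ∀ i ∈ s.erase i₀, f i ≠ 0 → (f i).natDegree < (f i₀).natDegree := by
        intro i hi hfi
        obtain ⟨hii₀, his⟩ := Finset.mem_erase.mp hi
        have hle := hmax i (Finset.mem_filter.mpr ⟨his, hfi⟩)
        exact lt_of_le_of_ne hle (hdist i his i₀ hi₀s hii₀ hfi hfi₀)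
      have hpos : 0 < (f i₀).natDegree := by
        obtain ⟨i, hi, hfi⟩ := hz
        exact lt_of_le_of_lt (Nat.zero_le _) (hlt i hi hfi)
      refine lt_of_le_of_lt (Polynomial.natDegree_sum_le_of_forall_le _ _ (n := (f i₀).natDegree - 1) ?_) (by omega)
      intro i hi
      by_cases hfi : f i = 0
      · rw [hfi, natDegree_zero]; exact Nat.zero_le _
      · have := hlt i hi hfi; omega
  have hsplit : f i₀ + ∑ i ∈ s.erase i₀, f i = 0 := by rw [Finset.add_sum_erase _ _ hi₀s]; exact hsum
  rcases hrest with hlt | hz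
  · have h1 : f i₀ = -∑ i ∈ s.erase i₀, f i := eq_neg_of_add_eq_zero_left hsplit
    have h2 : (f i₀).natDegree = (∑ i ∈ s.erase i₀, f i).natDegree := by rw [h1, natDegree_neg]
    omega
  · rw [hz, add_zero] at hsplit
    exact hfi₀ hsplit

/-- Trailing degree of a power over a domain. [folklore] -/
theorem natTrailingDegree_pow (P : R[X]) (k : ℕ) : (P ^ k).natTrailingDegree = k * P.natTrailingDegree := by
  by_cases hP : P = 0
  · rcases Nat.eq_zero_or_pos k with hk | hk
    · rw [hk, pow_zero, zero_mul, natTrailingDegree_one]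
    · rw [hP, zero_pow hk.ne', natTrailingDegree_zero, mul_zero]
  induction k with
  | zero => rw [pow_zero, zero_mul, natTrailingDegree_one]
  | succ k ih => rw [pow_succ, natTrailingDegree_mul (pow_ne_zero _ hP) hP, ih, Nat.succ_mul]

/-- The coefficient of `P^k` in degree `k · ord P` is `(trailing coefficient)^k`. [folklore] -/
theorem coeff_pow_mul_natTrailingDegree (P : R[X]) (k : ℕ) :
    (P ^ k).coeff (k * P.natTrailingDegree) = P.trailingCoeff ^ k := by
  induction k with
  | zero => simp
  | succ k ih =>
    rw [pow_succ, Nat.succ_mul, ← natTrailingDegree_pow P k, coeff_mul_natTrailingDegree_add_natTrailingDegree,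
      trailingCoeff, natTrailingDegree_pow, ih, pow_succ]

/-- **THE SECOND ROOT.**  Over a domain: `P ≠ 0`, `Σ_{c ≤ n} C(μ_c) X^{ρ(n−c)} P^c = 0` with `μ₀ ≠ 0`, `μ_n ≠ 0` ⇒
`P = C g * X^ρ` with `g ≠ 0` and `Σ_{c ≤ n} μ_c g^c = 0`. [OURS · L1 W4.3 · (o70-b)/(Δ12)] -/
theorem eq_C_mul_X_pow_of_rootRelation (n ρ : ℕ) (μ : ℕ → R) (hμ0 : μ 0 ≠ 0) (hμn : μ n ≠ 0)
    (P : R[X]) (hP : P ≠ 0) (h : ∑ c ∈ Finset.range (n + 1), C (μ c) * X ^ (ρ * (n - c)) * P ^ c = 0) :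
    ∃ g : R, g ≠ 0 ∧ P = C g * X ^ ρ ∧ ∑ c ∈ Finset.range (n + 1), μ c * g ^ c = 0 := by
  classical
  have h0mem : 0 ∈ Finset.range (n + 1) := Finset.mem_range.mpr (Nat.succ_pos n)
  have hnmem : n ∈ Finset.range (n + 1) := Finset.mem_range.mpr (Nat.lt_succ_self n)
  have hX : (X : R[X]) ≠ 0 := X_ne_zero
  -- (a) `deg P = ρ`: otherwise the degrees `ρ(n−c) + c·deg P` are pairwise distinct and the `c = 0` term survives
  have hdeg : P.natDegree = ρ := by
    by_contra hd
    have hdist : ∀ c ∈ Finset.range (n + 1), ∀ c' ∈ Finset.range (n + 1), c ≠ c' →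
        C (μ c) * X ^ (ρ * (n - c)) * P ^ c ≠ 0 → C (μ c') * X ^ (ρ * (n - c')) * P ^ c' ≠ 0 →
        (C (μ c) * X ^ (ρ * (n - c)) * P ^ c).natDegree ≠ (C (μ c') * X ^ (ρ * (n - c')) * P ^ c').natDegree := by
      intro c hc c' hc' hcc' hf hf' heq
      have hcn : c ≤ n := Nat.lt_succ_iff.mp (Finset.mem_range.mp hc)
      have hc'n : c' ≤ n := Nat.lt_succ_iff.mp (Finset.mem_range.mp hc')
      have hl : μ c ≠ 0 := by rintro h0; rw [h0, map_zero, zero_mul, zero_mul] at hf; exact hf rfl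
      have hl' : μ c' ≠ 0 := by rintro h0; rw [h0, map_zero, zero_mul, zero_mul] at hf'; exact hf' rfl
      have hdg : ∀ k, k ≤ n → μ k ≠ 0 →
          (C (μ k) * X ^ (ρ * (n - k)) * P ^ k).natDegree = ρ * (n - k) + k * P.natDegree := by
        intro k hk hlk
        rw [natDegree_mul (mul_ne_zero (by rwa [Ne, C_eq_zero]) (pow_ne_zero _ hX)) (pow_ne_zero _ hP),
          natDegree_C_mul hlk, natDegree_pow, natDegree_X, mul_one, natDegree_pow]
      rw [hdg c hcn hl, hdg c' hc'n hl'] at heq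
      have h1 : ((c : ℤ) - c') * ((P.natDegree : ℤ) - ρ) = 0 := by
        have heqZ : ((ρ * (n - c) + c * P.natDegree : ℕ) : ℤ) = ((ρ * (n - c') + c' * P.natDegree : ℕ) : ℤ) := by rw [heq]
        push_cast [Nat.cast_sub hcn, Nat.cast_sub hc'n] at heqZ
        linear_combination heqZ
      rcases mul_eq_zero.mp h1 with h2 | h2
      · exact hcc' (by exact_mod_cast sub_eq_zero.mp h2)
      · exact hd (by exact_mod_cast sub_eq_zero.mp h2)
    have hall := eq_zero_of_natDegree_injOn _ _ hdist h
    have h0 := hall 0 h0mem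
    simp only [Nat.sub_zero, pow_zero, mul_one] at h0
    exact (mul_ne_zero (by rwa [Ne, C_eq_zero]) (pow_ne_zero _ hX)) h0
  -- (b) `ord P = ρ`: otherwise the coefficient in degree `n · ord P` is `μ_n (trailing coeff)^n ≠ 0`
  have htρ : P.natTrailingDegree ≤ ρ := hdeg ▸ natTrailingDegree_le_natDegree P
  have hord : P.natTrailingDegree = ρ := by
    by_contra htne
    have htlt : P.natTrailingDegree < ρ := lt_of_le_of_ne htρ htne
    have hc := congr_arg (coeff · (n * P.natTrailingDegree)) h
    simp only [finsetSum_coeff, coeff_zero] at hc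
    rw [Finset.sum_eq_single n] at hc
    · -- the `c = n` term
      rw [Nat.sub_self, mul_zero, pow_zero, mul_one, coeff_C_mul, coeff_pow_mul_natTrailingDegree] at hc
      exact (mul_ne_zero hμn (pow_ne_zero _ (trailingCoeff_nonzero_iff_nonzero.mpr hP))) hc
    · -- the other terms vanish in degree `n · ord P`
      intro c hc hcn
      have hcn' : c < n := lt_of_le_of_ne (Nat.lt_succ_iff.mp (Finset.mem_range.mp hc)) hcn
      by_cases hz : C (μ c) * X ^ (ρ * (n - c)) * P ^ c = 0
      · rw [hz, coeff_zero]
      refine coeff_eq_zero_of_lt_natTrailingDegree ?_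
      have h1 := le_natTrailingDegree_mul hz
      have hz' : C (μ c) * X ^ (ρ * (n - c)) ≠ 0 := left_ne_zero_of_mul hz
      have h2 := le_natTrailingDegree_mul hz'
      rw [natTrailingDegree_C, zero_add, natTrailingDegree_pow, natTrailingDegree_X, mul_one] at h2
      rw [natTrailingDegree_pow] at h1
      -- `n · ord P < ρ(n−c) + c · ord P`
      have h4 : n * P.natTrailingDegree < ρ * (n - c) + c * P.natTrailingDegree := by
        obtain ⟨d, hd⟩ := Nat.exists_eq_add_of_lt hcn'
        rw [hd, show c + d + 1 - c = d + 1 by omega]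
        nlinarith
      omega
    · intro hnm; exact absurd hnmem hnm
  -- (c) `P = C g * X^ρ` with `g` the leading (= trailing) coefficient
  have hPeq : P = C P.leadingCoeff * X ^ ρ := by
    ext i
    rw [coeff_C_mul, coeff_X_pow]
    split_ifs with hi
    · rw [hi, mul_one, leadingCoeff, hdeg]
    · rw [mul_zero]
      rcases lt_or_gt_of_ne hi with hlt | hgt
      · exact coeff_eq_zero_of_lt_natTrailingDegree (by rw [hord]; exact hlt)
      · exact coeff_eq_zero_of_natDegree_lt (by rw [hdeg]; exact hgt)
  refine ⟨P.leadingCoeff, leadingCoeff_ne_zero.mpr hP, hPeq, ?_⟩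
  -- (d) the root relation: substitute `P = C g * X^ρ`
  have hsub : ∑ c ∈ Finset.range (n + 1), C (μ c) * X ^ (ρ * (n - c)) * P ^ c =
      C (∑ c ∈ Finset.range (n + 1), μ c * P.leadingCoeff ^ c) * X ^ (ρ * n) := by
    rw [map_sum, Finset.sum_mul]
    refine Finset.sum_congr rfl fun c hc => ?_
    have hcn : c ≤ n := Nat.lt_succ_iff.mp (Finset.mem_range.mp hc)
    conv_lhs => rw [hPeq]
    rw [mul_pow, ← map_pow, ← pow_mul, map_mul]
    have : (X : R[X]) ^ (ρ * (n - c)) * X ^ (ρ * c) = X ^ (ρ * n) := by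
      rw [← pow_add, ← Nat.mul_add, Nat.sub_add_cancel hcn]
    calc C (μ c) * X ^ (ρ * (n - c)) * (C (P.leadingCoeff ^ c) * X ^ (ρ * c))
        = C (μ c) * C (P.leadingCoeff ^ c) * (X ^ (ρ * (n - c)) * X ^ (ρ * c)) := by ring
      _ = C (μ c) * C (P.leadingCoeff ^ c) * X ^ (ρ * n) := by rw [this]
  rw [hsub, mul_eq_zero, C_eq_zero] at h
  rcases h with h | h
  · exact h
  · exact absurd h (pow_ne_zero _ hX)

end PolynomialD

end Iota3

end Summit.ResolutionOfSingularities.ResolutionOfSingularities.Cruxes.HypersurfaceCentreConstruction.LocalEngine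

end
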